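import Summits.BirchSwinnertonDyer.Rank1Residual.X1.ResidualDescent
import Summits.BirchSwinnertonDyer.Rank1Residual.X1.RankOneCongruenceTransfer
import Summits.BirchSwinnertonDyer.Rank1Residual.X1.RankOneCoefficientCertificate
import HarnessLib

/-!
# Route D at RANK ONE on class X1: Greenberg–Vatsal's residual descent bound
# `dim_{𝔽_p} Sel_m(E₀[p]/ℚ_m) = k ≤ λ_alg(E₀) + e` with `λ_an ≤ k − e + 1` and the ODD-parity squeeze
# ⇒ Mazur's main conjecture at a rank-one leaf pair; with the Schneider certificate ⇒ `BSD(E,p)`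

HONEST FRAMING (cell `b2b-bsdres`, run/shared/lean/b2b/bsd-rank1-residual/, verbatim in every
file): the goal of the cell is to DELETE the COMBINATION-SHAPED residual classes of the
Birch–Swinnerton-Dyer formula for ALL analytic-rank `≤ 1` elliptic curves over `ℚ` — "full BSD
formula for every rank `≤ 1` curve in class `C`" assembled STRICTLY from published theorems — so
that the rank-`≤ 1` remainder becomes exactly the CONSTRUCTION-SHAPED classes, which are TYPED
(missing-input `Prop`s), NOT attempted. This is not "finishing BSD". Unit `b2b-bsdres-x1a` (X1 prover
A; CLASS-OWNERS row "X1 (r = 1)"), gen 13: research route; NO CLAIM BEYOND STATED CLASSES; nothing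
here changes a label; no new named fact, no new def (theorems only, over PUBLISHED named facts and
sub-cell eisenstein-p1's typed per-pair inputs `ResidualDescentBound`, `AnalyticLambdaEq`, `AnalyticMuLE`).

WHY THIS FILE. Sub-cell eisenstein-p1's ROUTE D (`X1/ResidualDescent.lean`, gen 8): for the `μ = 0`
member `E₀` of a leaf class, every Kummer class of the RESIDUAL representation `E₀[p]` over a finite
cyclotomic layer `ℚ_m` that satisfies Greenberg's inertia condition at `p` is a witness for `λ_alg(E₀)`:
`k := dim_{𝔽_p} ker(H¹(ℚ_Σ/ℚ_m, E₀[p]) → H¹(I_{𝔭_m}, E₀[p]/F⁺)) ≤ λ_alg(E₀) + e`,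
`e = [E₀(ℚ)[p] ≠ 0] + Σ_{ℓ ∣ N} min(s_ℓ, p^m)·d_ℓ(E₀)` (Greenberg–Vatsal, Invent. Math. 142 (2000) §2
Prop. (2.8), Cor. (2.3), Prop. (2.4); Greenberg LNM 1716 Prop. 4.15 — the typed per-pair input
`ResidualDescentBound W p k e`, the integer `k` computed EXACTLY outside the kernel by Kummer theory over
`ℚ(ζ_{p^{m+1}}, E₀[p])`, X1R0-GAPMAP §17). NOTHING in that bound refers to the Mordell–Weil rank: the
rational points contribute to `λ_alg` itself, and `dim S_{E₀[p^∞]}(ℚ_∞)[p] = λ_alg` at `μ = 0` holds at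
every rank (Prop. 4.15 has no rank clause over `ℚ`). eisenstein-p1 filed the consumer on the RANK-ZERO
leaf only (`ResidualDescent.Leaf.bsdp_of_muZero_of_residualDescent`, EVEN parity) and handed the
rank-one λ-parts to x1a/x1b (HANDOFF eisenstein-p1 GEN 8: "x1b/x1a: the r=1 λ-parts
(routeD_closures.json)" — 27 rank-one classes `N < 2·10⁴` closed directly at level `m = 1`, 0 violations
of `k − e ≤ λ_an` on 651 rank-one classes). This file is the rank-one consumer, the exact mirror of
eisenstein-p1's §2–§3 at Selmer corank `1` and the route-D twin of x1a's `X1/RankOneTamagawaSqueeze.lean`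
(route T) / `X1/RankOneCongruenceTransfer.lean` (route G):

* §1 `lambdaPartAt_of_residualDescentBound_of_odd`: `λ(f_E) ≥ k − e` (input, at `μ(X) = 0` which
  `μ_an = 0` gives by Kato–Wuthrich), `λ(f_E)` ODD (Greenberg Prop. 3.10 at corank `1`),
  `λ(f_E·h) = λ_an = n` odd, `n + e ≤ k + 1` ⇒ `λ(h)` even and `≤ 1` ⇒ `0`: the λ-part;
  `mazurMainConjecture_of_residualDescentBound_of_odd` (+ the μ-part, automatic at `μ_an = 0`).
* §2 on the rank-one leaf `RankOne.Leaf` (BOTH Greenberg–Vatsal types): corank `1` by GZK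
  (`RankOne.Leaf.selmerCorank_eq_one`), `λ_an` odd automatically (x1b's `RankOne.Leaf.odd_of_analyticLambdaEq`,
  Mazur–Tate–Teitelbaum): **`RankOne.Leaf.mazurMainConjecture_of_muZero_of_residualDescent`**
  (`μ_an = 0 ∧ λ_an = n ∧ ResidualDescentBound k e ∧ n + e ≤ k + 1 ⇒` Mazur's MC); consistency
  `RankOne.Leaf.le_of_residualDescentBound` (`k ≤ n + e`, Kato's direction — the census's falsification
  test at rank one); and route D feeding route G at rank one (`…_of_congruent_of_residualDescent_rankZero`
  / `_rankOne`: the closed relative is a leaf pair of either rank closed by route D).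
* §3 `BSD(E,p)`: + Schneider's non-degeneracy at the pair (x1a `RankOne.Leaf.bsdp_of_mazurMainConjecture_of_schneider`:
  Perrin-Riou–Schneider, Perrin-Riou 1987, Mazur–Tate `σ`, modularity, GZK — all PUBLISHED), in the
  three certificate currencies (`SchneiderConjecture` at THE canonical height; `[T¹]L_p(f,α) ≠ 0`;
  `p^{-v} ≤ ‖[T¹](ϖ·L_p(f,α))‖_p`). NO `#Ш(E/ℚ)_an` input.

Census instance (eisenstein-p1 `routeD/routeD_p3_N2e4.tsv`, not a verdict): `220a1 @ 3`, `r_an = 1`,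
`λ_an = 5`, `μ(220a1) = 0`, Kummer class `B = 44`, `#Σ₀ = 3`: level `m = 0` gives `k = 4`, `e = 2`
(`k − e = 2`, short); level `m = 1` (`ℚ_1 = ℚ(ζ_9)⁺`, field `ℚ(ζ_9, ∛44)` of degree 18) gives `k = 6`,
`e = 2`, so `λ_alg ≥ 4 = λ_an − 1` and parity closes: `5 + 2 ≤ 6 + 1`. A pair on which routes
P₁/P₃/G/T⁺ of x1a gens 10–12 are silent (`t_1 = 0` Tamagawa primes, no closed congruent relative).

What this is NOT: a class theorem (`k`, `e`, `λ_an`, `μ_an` and the certificate are per pair, supplied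
outside the kernel); a change of the class-level residue (X1-CHAIN §17b: A1 = Mazur's MC at anomalous
type-A pairs — unstated in print, Keller–Yin PRE — plus Schneider; B1 = Schneider).

References: [GreenbergVatsal2000] §2: Props. (2.1), (2.4), (2.5), (2.8), Cor. (2.3), pp. 16–17, 23–27 of
arXiv:math/9906215; [GreenbergLNM1716] Prop. 3.10, Prop. 4.15 / p. 161; [Wuthrich2014] Thm. 16;
[BalakrishnanMullerStein2015] Thm. 1.7; [PerrinRiou1987] §1.4 Cor. 1.8; [MazurTateTeitelbaum1986Invent]
§I.17–I.18; [SteinWuthrich2013] §§3–4, §9; HOME/b2b-bsdres-eisenstein-p1/X1R0-GAPMAP.md §17;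
HOME/b2b-bsdres-x1a/X1-CHAIN.md §20–§22.
-/

noncomputable section

open scoped Classical MatrixGroups ModularForm

open PowerSeries CongruenceSubgroup WeierstrassCurve Literature.NumberTheory.EllipticCurves
  Literature.NumberTheory.EllipticCurves.ModularForms
  Literature.NumberTheory.EllipticCurves.Wuthrich2014
  Literature.NumberTheory.EllipticCurves.Rank1Residual
  Literature.NumberTheory.EllipticCurves.Greenberg1999
  Summit.BirchSwinnertonDyer.BirchSwinnertonDyer.Theorems
  Summit.BirchSwinnertonDyer.BirchSwinnertonDyer.Theorems.Rank1ResidualX1Defs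
  Summit.BirchSwinnertonDyer.Rank1Residual.X1.MuLambda
  Summit.BirchSwinnertonDyer.Rank1Residual.X1.MuPart
  Summit.BirchSwinnertonDyer.Rank1Residual.X1.ParitySqueeze
  Summit.BirchSwinnertonDyer.Rank1Residual.X1.TamagawaSqueeze
  Summit.BirchSwinnertonDyer.Rank1Residual.X1.CongruenceTransfer
  Summit.BirchSwinnertonDyer.Rank1Residual.X1.ResidualDescent
  Summit.BirchSwinnertonDyer.Rank1Residual.X1.RankOneCongruenceTransfer

set_option autoImplicit false

namespace Summit.BirchSwinnertonDyer.Rank1Residual.X1.RankOneResidualDescent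

/-! ## §1. Route D with the ODD-parity squeeze (Selmer corank `1`) -/

section Squeeze

variable {W : WeierstrassCurve ℚ} [W.IsElliptic] [W.IsGloballyMinimal] {p : ℕ} [Fact p.Prime]

/-- **Route D, λ-part with ODD parity (Selmer corank `1`).** `W/ℚ` globally minimal elliptic, `p ≠ 2`
good ordinary with `E[p]` reducible and `corank_{ℤ_p} Sel_{p^∞}(E/ℚ) = 1` (`hcork`); granted Wuthrich
2014 Thm. 16 (`hW16`), Greenberg's Prop. 3.10 (`h310`) and modularity (`hmod`), all PUBLISHED: if
`μ_an(E,p) = 0` (`AnalyticMuLE W p 0`, so `μ(X) = 0` by Kato–Wuthrich), `λ_an(E,p) = n` is ODD, the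
descent bound `ResidualDescentBound W p k e` (`k ≤ λ(X) + e` at `μ(X) = 0`) holds and `n + e ≤ k + 1`,
then the λ-part `LambdaPartAt W p` holds: `λ(f_E) = λ(X) ≥ k − e ≥ n − 1` is odd (Prop. 3.10 at corank
`1`), `λ(f_E·h) = n` is odd, so `λ(h) = n − λ(f_E)` is even and `≤ 1`, hence `0`. The rank-one twin of
eisenstein-p1's `ResidualDescent.lambdaPartAt_of_residualDescentBound_of_even`.
[cite: GreenbergVatsal2000, §2 Prop. (2.8), Cor. (2.3), Prop. (2.4), pp. 25–27]
[cite: GreenbergLNM1716, Prop. 3.10 and Prop. 4.15 (p. 161)] [cite: Wuthrich2014, Thm. 16 (p. 397)] -/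
theorem lambdaPartAt_of_residualDescentBound_of_odd
    (hW16 : Wuthrich2014.charIdeal_dvd_padicLFunction)
    (h310 : prop310_selmerCorank_mod_two_eq_lambdaInvariant)
    (hmod : nonempty_modularParametrizationData)
    (hp : p ≠ 2) (hgood : W.HasGoodReductionAtPrime p) (hord : ¬ (p : ℤ) ∣ W.frobeniusTrace p)
    (hred : ¬ W.HasIrreducibleModPGaloisRep p) (hcork : W.selmerCorank p = 1)
    (hμ : AnalyticMuLE W p 0) {k e : ℕ} (hD : ResidualDescentBound W p k e)
    {n : ℕ} (hn : Odd n) (hlam : AnalyticLambdaEq W p n) (hne : n + e ≤ k + 1) :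
    LambdaPartAt W p := by
  intro κ γ hκ hγ hγ' _ f hf ϖ hϖ D g h hchar hι
  haveI : Module.Finite (IwasawaAlgebra p) D.X := D.module_finite_holds hγ
  obtain ⟨hX, -⟩ := hW16 W p hp ⟨hgood, hord⟩ hred hκ hγ hγ' hf D ϖ hϖ
  have hgh : g * h ≠ 0 := mul_ne_zero_of_iota_eq hgood hord hf hϖ D hι
  have hg : g ≠ 0 := fun h0 ↦ hgh (by rw [h0, zero_mul])
  have hh : h ≠ 0 := fun h0 ↦ hgh (by rw [h0, mul_zero])
  have h1 : lam (g * h) = n := hlam f hf ϖ hϖ (g * h) hι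
  have h2 : lam g = lambdaInvariant p D.X := lam_generator_eq_lambdaInvariant D.X hX hg hchar
  obtain ⟨-, h3⟩ := ResidualDescent.isTorsion_and_le_lambdaInvariant_of_residualDescentBound hW16 hmod
    hp hgood hord hred hμ hD hκ hγ hγ' D
  have hodd : Odd (lam g) := by
    rw [h2]
    exact prop310_selmerCorank_mod_two_eq_lambdaInvariant.odd_lambdaInvariant_of_selmerCorank_eq_one
      h310 W p hp hκ hγ D hX hcork
  have hgh2 : Odd (lam (g * h)) := by rw [h1]; exact hn
  rw [lam_mul hg hh] at h1 hgh2 ⊢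
  obtain ⟨a, ha⟩ := hodd
  obtain ⟨b, hb⟩ := hgh2
  omega

/-- **Route D with ODD parity: Mazur's main conjecture** from `μ_an = 0` (μ-part automatic,
`MuPart.muPartAt_of_analyticMuLE_zero`), `λ_an = n` odd, the descent bound `ResidualDescentBound W p k e`
and `n + e ≤ k + 1`, at Selmer corank `1` (Wuthrich Thm. 16: `MC ⟺ μ-part ∧ λ-part`, `X1/MuLambda.lean`).
[cite: GreenbergVatsal2000, §2 pp. 25–27] [cite: GreenbergLNM1716, Prop. 3.10]
[cite: Wuthrich2014, Thm. 16 (p. 397)] -/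
theorem mazurMainConjecture_of_residualDescentBound_of_odd
    (hW16 : Wuthrich2014.charIdeal_dvd_padicLFunction)
    (h310 : prop310_selmerCorank_mod_two_eq_lambdaInvariant)
    (hmod : nonempty_modularParametrizationData)
    (hp : p ≠ 2) (hgood : W.HasGoodReductionAtPrime p) (hord : ¬ (p : ℤ) ∣ W.frobeniusTrace p)
    (hred : ¬ W.HasIrreducibleModPGaloisRep p) (hcork : W.selmerCorank p = 1)
    (hμ : AnalyticMuLE W p 0) {k e : ℕ} (hD : ResidualDescentBound W p k e)
    {n : ℕ} (hn : Odd n) (hlam : AnalyticLambdaEq W p n) (hne : n + e ≤ k + 1) :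
    MazurMainConjecture W p :=
  (mazurMainConjecture_iff_muPart_and_lambdaPart hW16 hp hgood hord hred).mpr
    ⟨muPartAt_of_analyticMuLE_zero hW16 hp hgood hord hred hμ,
      lambdaPartAt_of_residualDescentBound_of_odd hW16 h310 hmod hp hgood hord hred hcork hμ hD hn hlam
        hne⟩

end Squeeze

/-! ## §2. On the rank-one leaf X1 ∩ {r = 1}: route D closes Mazur's main conjecture -/

section Leaf

variable {W W' : WeierstrassCurve ℚ} [W.IsElliptic] [W.IsGloballyMinimal]
  [W'.IsElliptic] [W'.IsGloballyMinimal] {p : ℕ} [Fact p.Prime]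

/-- **Route D on the rank-one leaf: Mazur's main conjecture at `E₀`** from `μ_an(E₀) = 0`, `λ_an(E₀) = n`,
the descent bound `dim_{𝔽_p} Sel_m(E₀[p]/ℚ_m) = k ≤ λ_alg(E₀) + e` (`ResidualDescentBound W p k e`) and
`n + e ≤ k + 1` — parity automatic on the leaf (`λ_an` odd: x1b's `RankOne.Leaf.odd_of_analyticLambdaEq`,
Mazur–Tate–Teitelbaum; `λ(f_E)` odd: Prop. 3.10 at corank `1`, `RankOne.Leaf.selmerCorank_eq_one` by
GZK). Facts `hW16`, `h310`, `hmod`, `hGZK` all PUBLISHED; either Greenberg–Vatsal type. Census instance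
`220a1 @ 3` (module docstring): `n = 5`, `m = 1`, `k = 6`, `e = 2`.
[cite: GreenbergVatsal2000, §2 Prop. (2.8), Cor. (2.3), Prop. (2.4), pp. 25–27]
[cite: GreenbergLNM1716, Prop. 3.10 and Prop. 4.15 (p. 161)] [cite: Wuthrich2014, Thm. 16 (p. 397)]
[cite: MazurTateTeitelbaum1986Invent, §I.17–I.18] -/
theorem _root_.Summit.BirchSwinnertonDyer.Rank1Residual.X1.RankOne.Leaf.mazurMainConjecture_of_muZero_of_residualDescent
    (hW16 : Wuthrich2014.charIdeal_dvd_padicLFunction)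
    (h310 : prop310_selmerCorank_mod_two_eq_lambdaInvariant)
    (hmod : nonempty_modularParametrizationData)
    (hGZK : rank_eq_analyticRank_of_analyticRank_le_one) (hL : RankOne.Leaf W p)
    (hμ0 : AnalyticMuLE W p 0) {k e : ℕ} (hD : ResidualDescentBound W p k e)
    {n : ℕ} (hlam : AnalyticLambdaEq W p n) (hne : n + e ≤ k + 1) : MazurMainConjecture W p :=
  have hX := isClassX1_of_classX1 hL.1
  mazurMainConjecture_of_residualDescentBound_of_odd hW16 h310 hmod hX.two_ne hX.hasGoodReductionAtPrime
    hX.not_dvd_frobeniusTrace hX.not_hasIrreducibleModPGaloisRep (hL.selmerCorank_eq_one hGZK) hμ0 hD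
    (hL.odd_of_analyticLambdaEq hW16 hmod hlam) hlam hne

/-- **Consistency on the rank-one leaf (Kato–Wuthrich direction): a descent bound never exceeds
`λ_an(E₀) + e`**, `k ≤ n + e` — the rank-one copy of eisenstein-p1's `ResidualDescent.Leaf.le_of_residualDescentBound`
(the argument uses only X1-membership: the data exist — modularity, the cyclotomic `κ, γ`, a dual datum —
and `ϖ·L_p = ι(f_E·h)` gives `n = λ(f_E) + λ(h) ≥ λ(f_E) = λ(X) ≥ k − e`). This is the FALSIFICATION TEST
of the rank-one census (eisenstein-p1 routeD: `k − e ≤ λ_an` at 651/651 rank-one classes `N < 2·10⁴`).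
[cite: GreenbergVatsal2000, §2 pp. 25–27] [cite: Wuthrich2014, Thm. 16 (p. 397)] -/
theorem _root_.Summit.BirchSwinnertonDyer.Rank1Residual.X1.RankOne.Leaf.le_of_residualDescentBound
    (hW16 : Wuthrich2014.charIdeal_dvd_padicLFunction) (hmod : nonempty_modularParametrizationData)
    (hL : RankOne.Leaf W p) (hμ0 : AnalyticMuLE W p 0) {k e : ℕ} (hD : ResidualDescentBound W p k e)
    {n : ℕ} (hlam : AnalyticLambdaEq W p n) : k ≤ n + e := by
  have hX := isClassX1_of_classX1 hL.1
  haveI : NeZero (W.conductorNorm ℤ) := ⟨(W.conductorNorm_pos_holds).ne'⟩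
  obtain ⟨κ, hκ, γ, hγ, hγ'⟩ := exists_isCyclotomic_isTopGenerator_isCyclotomicVariable_holds p
  obtain ⟨D⟩ := W.nonempty_selmerDualData_holds κ γ hγ
  haveI : Module.Finite (IwasawaAlgebra p) D.X := D.module_finite_holds hγ
  obtain ⟨hXt, f, ϖ, g, h, hf, hϖ, hchar, hι⟩ := isTorsion_and_exists_factorisation hW16 hmod
    hX.two_ne hX.hasGoodReductionAtPrime hX.not_dvd_frobeniusTrace hX.not_hasIrreducibleModPGaloisRep
    hκ hγ hγ' D
  have hgh : g * h ≠ 0 :=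
    mul_ne_zero_of_iota_eq hX.hasGoodReductionAtPrime hX.not_dvd_frobeniusTrace hf hϖ D hι
  have hg0 : g ≠ 0 := fun h0 ↦ hgh (by rw [h0, zero_mul])
  have hh0 : h ≠ 0 := fun h0 ↦ hgh (by rw [h0, mul_zero])
  have h1 : lam (g * h) = n := hlam f hf ϖ hϖ (g * h) hι
  have h2 : lam g = lambdaInvariant p D.X := lam_generator_eq_lambdaInvariant D.X hXt hg0 hchar
  obtain ⟨-, h3⟩ := ResidualDescent.isTorsion_and_le_lambdaInvariant_of_residualDescentBound hW16 hmod
    hX.two_ne hX.hasGoodReductionAtPrime hX.not_dvd_frobeniusTrace hX.not_hasIrreducibleModPGaloisRep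
    hμ0 hD hκ hγ hγ' D
  have h4 : lam g ≤ lam (g * h) := lam_le_lam_mul hg0 hh0
  omega

/-- **Route D feeding route G at rank one, rank-ZERO relative.** On the rank-one leaf, Mazur's main
conjecture at `E₀` from a CONGRUENT rank-zero leaf pair `E₀'` (`E₀[p] ≅ E₀'[p]`, transfer datum
`λ(E₀) = λ(E₀') + s`, both `μ_an = 0`) whose own main conjecture route D closes
(`ResidualDescent.Leaf.mazurMainConjecture_of_residualDescent`: `λ_an(E₀') = n'`, descent bound `k' e'`,
`n' + e' ≤ k' + 1`), and `λ_an(E₀) = n ≤ n' + s + 1`. Composition of eisenstein-p1's route D (rank-`0`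
leaf) with x1a's route G at rank one (`RankOne.Leaf.mazurMainConjecture_of_congruent_classX1`); the
census's "closed by G inside a route-D family" at a rank-one member.
[cite: GreenbergVatsal2000, §2 pp. 25–27] [cite: GreenbergLNM1716, Prop. 3.10]
[cite: Wuthrich2014, Thm. 16 (p. 397)] -/
theorem _root_.Summit.BirchSwinnertonDyer.Rank1Residual.X1.RankOne.Leaf.mazurMainConjecture_of_congruent_of_residualDescent_rankZero
    (hW16 : Wuthrich2014.charIdeal_dvd_padicLFunction)
    (h310 : prop310_selmerCorank_mod_two_eq_lambdaInvariant)
    (hmod : nonempty_modularParametrizationData)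
    (hGZK : rank_eq_analyticRank_of_analyticRank_le_one) (hL : RankOne.Leaf W p)
    (hL' : RankZero.Leaf W' p) (hμ : AnalyticMuLE W p 0) (hμ' : AnalyticMuLE W' p 0)
    {k' e' : ℕ} (hD' : ResidualDescentBound W' p k' e') {n' : ℕ} (hlam' : AnalyticLambdaEq W' p n')
    (hne' : n' + e' ≤ k' + 1) (hiso : TorsionIso W W' p) {s : ℤ} (hG : CongruentLambdaShift W W' p s)
    {n : ℕ} (hlam : AnalyticLambdaEq W p n) (hne : (n : ℤ) ≤ n' + s + 1) :
    MazurMainConjecture W p :=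
  hL.mazurMainConjecture_of_congruent_classX1 hW16 h310 hmod hGZK hL'.classX1 hμ hμ'
    (ResidualDescent.Leaf.mazurMainConjecture_of_residualDescent hW16 h310 hmod hGZK hL' hμ' hD' hlam'
      hne') hlam' hiso hG hlam hne

/-- **Route D feeding route G at rank one, rank-ONE relative.** As
`RankOne.Leaf.mazurMainConjecture_of_congruent_of_residualDescent_rankZero`, with the congruent relative
`E₀'` itself on the rank-one leaf and closed by route D at rank one
(`RankOne.Leaf.mazurMainConjecture_of_muZero_of_residualDescent`).
[cite: GreenbergVatsal2000, §2 pp. 25–27] [cite: GreenbergLNM1716, Prop. 3.10]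
[cite: Wuthrich2014, Thm. 16 (p. 397)] -/
theorem _root_.Summit.BirchSwinnertonDyer.Rank1Residual.X1.RankOne.Leaf.mazurMainConjecture_of_congruent_of_residualDescent_rankOne
    (hW16 : Wuthrich2014.charIdeal_dvd_padicLFunction)
    (h310 : prop310_selmerCorank_mod_two_eq_lambdaInvariant)
    (hmod : nonempty_modularParametrizationData)
    (hGZK : rank_eq_analyticRank_of_analyticRank_le_one) (hL : RankOne.Leaf W p)
    (hL' : RankOne.Leaf W' p) (hμ : AnalyticMuLE W p 0) (hμ' : AnalyticMuLE W' p 0)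
    {k' e' : ℕ} (hD' : ResidualDescentBound W' p k' e') {n' : ℕ} (hlam' : AnalyticLambdaEq W' p n')
    (hne' : n' + e' ≤ k' + 1) (hiso : TorsionIso W W' p) {s : ℤ} (hG : CongruentLambdaShift W W' p s)
    {n : ℕ} (hlam : AnalyticLambdaEq W p n) (hne : (n : ℤ) ≤ n' + s + 1) :
    MazurMainConjecture W p :=
  hL.mazurMainConjecture_of_congruent_classX1 hW16 h310 hmod hGZK hL'.1 hμ hμ'
    (hL'.mazurMainConjecture_of_muZero_of_residualDescent hW16 h310 hmod hGZK hμ' hD' hlam' hne') hlam'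
    hiso hG hlam hne

end Leaf

/-! ## §3. `BSD(E,p)` on the rank-one leaf: route D + the Schneider certificate — no `#Ш(E/ℚ)_an` -/

section BSD

variable {W : WeierstrassCurve ℚ} [W.IsElliptic] [W.IsGloballyMinimal] {p : ℕ} [Fact p.Prime]

/-- **Route D ⇒ Mazur's main conjecture ∧ `BSD(E₀,p)` on the rank-one leaf, modulo Schneider at the
pair** (`hSch`: THE canonical cyclotomic height is non-degenerate; x1a's
`RankOne.Leaf.bsdp_of_mazurMainConjecture_of_schneider` — Perrin-Riou–Schneider `hS`, Perrin-Riou 1987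
`hPR`, Mazur–Tate sigma `hMT`, modularity, GZK, all PUBLISHED). No `#Ш(E/ℚ)_an` input: the main
conjecture comes from the descent witnesses, not from `p ∤ #Ш_an`.
[cite: GreenbergVatsal2000, §2 pp. 25–27] [cite: GreenbergLNM1716, Prop. 3.10]
[cite: Wuthrich2014, Thm. 16 (p. 397)] [cite: BalakrishnanMullerStein2015, Thm. 1.7]
[cite: PerrinRiou1987, §1.4 Cor. 1.8] -/
theorem _root_.Summit.BirchSwinnertonDyer.Rank1Residual.X1.RankOne.Leaf.mazurMainConjecture_and_bsdp_of_muZero_of_residualDescent_of_schneider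
    (hW16 : Wuthrich2014.charIdeal_dvd_padicLFunction)
    (h310 : prop310_selmerCorank_mod_two_eq_lambdaInvariant)
    (hS : Schneider1985_order_charGenerator_odd) (hPR : perrinRiou_rankOne_leadingTerms_odd)
    (hMT : mazur_tate_sigma_exists_odd) (hmod : nonempty_modularParametrizationData)
    (hGZK : rank_eq_analyticRank_of_analyticRank_le_one) (hL : RankOne.Leaf W p)
    (hμ0 : AnalyticMuLE W p 0) {k e : ℕ} (hD : ResidualDescentBound W p k e)
    {n : ℕ} (hlam : AnalyticLambdaEq W p n) (hne : n + e ≤ k + 1)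
    (hSch : ∀ Dh : PAdicHeightData W p, Dh.IsCanonical → SchneiderConjecture Dh) :
    MazurMainConjecture W p ∧ BSDp W p :=
  have hMC : MazurMainConjecture W p :=
    hL.mazurMainConjecture_of_muZero_of_residualDescent hW16 h310 hmod hGZK hμ0 hD hlam hne
  ⟨hMC, hL.bsdp_of_mazurMainConjecture_of_schneider hS hPR hMT hmod hGZK hSch hMC⟩

/-- **Route D in certificate currency: `μ_an = 0 ∧ λ_an = n ∧ ResidualDescentBound k e ∧ n + e ≤ k + 1`
+ `[T¹]L_p(f,α,T) ≠ 0` (for SOME newform `f` of `E₀`) ⇒ Mazur's MC ∧ `BSD(E₀,p)`** on the rank-one leaf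
(converter `RankOne.Leaf.schneider_of_coeff_one_ne_zero`, Perrin-Riou 1987 + GZK). No `#Ш_an`, no height
computation. [cite: GreenbergVatsal2000, §2 pp. 25–27] [cite: GreenbergLNM1716, Prop. 3.10]
[cite: Wuthrich2014, Thm. 16 (p. 397)] [cite: PerrinRiou1987, §1.4 Cor. 1.8]
[cite: SteinWuthrich2013, §§3–4, §9] -/
theorem _root_.Summit.BirchSwinnertonDyer.Rank1Residual.X1.RankOne.Leaf.mazurMainConjecture_and_bsdp_of_muZero_of_residualDescent_of_coeff_one_ne_zero
    (hW16 : Wuthrich2014.charIdeal_dvd_padicLFunction)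
    (h310 : prop310_selmerCorank_mod_two_eq_lambdaInvariant)
    (hS : Schneider1985_order_charGenerator_odd) (hPR : perrinRiou_rankOne_leadingTerms_odd)
    (hMT : mazur_tate_sigma_exists_odd) (hmod : nonempty_modularParametrizationData)
    (hGZK : rank_eq_analyticRank_of_analyticRank_le_one) (hL : RankOne.Leaf W p)
    (hμ0 : AnalyticMuLE W p 0) {k e : ℕ} (hD : ResidualDescentBound W p k e)
    {n : ℕ} (hlam : AnalyticLambdaEq W p n) (hne : n + e ≤ k + 1)
    {N : ℕ} [NeZero N] (f : CuspForm (Gamma0 N) 2) (hf : IsNewformOf W f)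
    (hcoeff : coeff 1 (padicLFunction f (unitRoot W p : ℚ_[p])) ≠ 0) :
    MazurMainConjecture W p ∧ BSDp W p :=
  hL.mazurMainConjecture_and_bsdp_of_muZero_of_residualDescent_of_schneider hW16 h310 hS hPR hMT hmod
    hGZK hμ0 hD hlam hne (hL.schneider_of_coeff_one_ne_zero hPR hGZK f hf hcoeff)

/-- **Route D, headline in the finite-precision currency a modular-symbol engine certifies:
`μ_an = 0 ∧ λ_an = n ∧ dim Sel_m(E₀[p]) = k ≤ λ_alg + e ∧ n + e ≤ k + 1` + `p^{-v} ≤ ‖[T¹](ϖ·L_p(f,α))‖_p`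
⇒ Mazur's MC ∧ `BSD(E₀,p)`** on the rank-one leaf (x1a `RankOne.coeff_one_ne_zero_of_le_norm_coeff_one_smul`).
Census instance `220a1 @ 3`: `n = 5`, `m = 1`, `k = 6`, `e = 2`; `[T¹]L_3 ≠ 0` certified by the cell's
engine C (x1a LW-FALLOUT-X1: `[T¹]L_p ≠ 0` at 12 222 / 12 315 rank-one X1 class-pairs `N < 5·10⁵`).
No `#Ш_an`. [cite: GreenbergVatsal2000, §2 pp. 25–27] [cite: GreenbergLNM1716, Prop. 3.10]
[cite: Wuthrich2014, Thm. 16 (p. 397)] [cite: PerrinRiou1987, §1.4 Cor. 1.8]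
[cite: SteinWuthrich2013, §§3–4, §9] -/
theorem _root_.Summit.BirchSwinnertonDyer.Rank1Residual.X1.RankOne.Leaf.mazurMainConjecture_and_bsdp_of_muZero_of_residualDescent_of_le_norm_coeff_one
    (hW16 : Wuthrich2014.charIdeal_dvd_padicLFunction)
    (h310 : prop310_selmerCorank_mod_two_eq_lambdaInvariant)
    (hS : Schneider1985_order_charGenerator_odd) (hPR : perrinRiou_rankOne_leadingTerms_odd)
    (hMT : mazur_tate_sigma_exists_odd) (hmod : nonempty_modularParametrizationData)
    (hGZK : rank_eq_analyticRank_of_analyticRank_le_one) (hL : RankOne.Leaf W p)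
    (hμ0 : AnalyticMuLE W p 0) {k e : ℕ} (hD : ResidualDescentBound W p k e)
    {n : ℕ} (hlam : AnalyticLambdaEq W p n) (hne : n + e ≤ k + 1)
    {N : ℕ} [NeZero N] (f : CuspForm (Gamma0 N) 2) (hf : IsNewformOf W f) (ϖ : ℚ_[p]) (v : ℕ)
    (hcoeff : (p : ℝ) ^ (-(v : ℤ)) ≤ ‖coeff 1 (C ϖ * padicLFunction f (unitRoot W p : ℚ_[p]))‖) :
    MazurMainConjecture W p ∧ BSDp W p :=
  have hpP : p.Prime := Fact.out
  hL.mazurMainConjecture_and_bsdp_of_muZero_of_residualDescent_of_coeff_one_ne_zero hW16 h310 hS hPR hMT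
    hmod hGZK hμ0 hD hlam hne f hf
    (RankOne.coeff_one_ne_zero_of_le_norm_coeff_one_smul _ ϖ (zpow_pos (by exact_mod_cast hpP.pos) _)
      hcoeff)

end BSD

end Summit.BirchSwinnertonDyer.Rank1Residual.X1.RankOneResidualDescent

end
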